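import Summits.CriticalPhenomena.PercolationContinuityZ3.Theorems.PercNearOneGluingNoHeavyLowerTailSahiE3Hitting
import Mathlib.Tactic.Linarith
import Mathlib.Tactic.Ring
import Mathlib.Tactic.Positivity
import HarnessLib

/-!
# Laminar hitting triples: closed forms of Sahi's `E₃` and CONCAVITY along every coordinate (the chord inequality)

Support file for the Sahi programme (`--supports stmt-CriticalPhenomena-4575`, prover prim-sahi-p2 gen 18).  No definitions, no named
facts, no sorries; standard axioms.  Memo `run/shared/lean/prim/prim-sahi/prim-sahi-p2/PROOF-E3.md` §28c–§28e.

Setting: the weighted cube on a finite coordinate set `D` (`ED`, `wtW` of `Literature.Probability.Percolation.DecisionTree`, coordinate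
probabilities `p ∈ [0,1]^ι`) and the HITTING indicators `u_X(S) = 1[S ∩ X ≠ ∅]` of three finite sets `A, B, C`.  File
`…SahiE3Hitting` proves `E₃(u_A,u_B,u_C) ≥ 0` for ARBITRARY `A, B, C` (Venn polynomial).  Here we treat the LAMINAR case — the three
sets pairwise EQUAL OR DISJOINT —, which is the shape of the increasing-star events once the environment is revealed: given the states of all
pairs of `G − s`, the events `{s ↔ t}` are the hitting events, for the product-random set of open ROOT pairs, of the traces of the clusters
`C_t(G − s)` on the root's neighbourhood, and two such traces coincide or are disjoint.

* `ED_hit_one`, `ED_hit_two`, `ED_hit_three` — the moments of one, two, three hitting indicators through the avoidance products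
  `q(X) = ∏_{i ∈ D} (1 − p_i if i ∈ X else 1)` of unions (inclusion–exclusion); `sahiE3_hitting_expand` — `E₃` through the seven `q`'s.
* `prod_avoid_union` — `q(X ∪ Y) = q(X)·q(Y)` for disjoint `X, Y`.
* CLOSED FORMS: `sahiE3_hitting_eq_of_eq_eq` — `E₃(u_A,u_A,u_A) = (1 − q_A)·q_A·(1 + q_A)`;
  `sahiE3_hitting_eq_of_eq_disjoint` — `E₃(u_A,u_A,u_C) = (1 − q_C)·(1 − q_A)·q_A` for `A ∩ C = ∅` (and the two other positions of the
  repeated set, `…_of_disjoint_eq`, `…_of_eq_mid_disjoint`); `sahiE3_hitting_eq_zero_of_pairwise_disjoint` — `E₃ = 0`.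
* `prod_avoid_update` — along one coordinate `u ∈ D`, `q_X` is `(1 − t·1[u ∈ X])` times a `t`-free product: affine in `t = p_u`.
* **`sahiE3_hitting_laminar_chord`** — for laminar `A, B, C`, every `u ∈ D` and `t ∈ [0,1]`:
  `(1 − t)·E₃(p[u ↦ 0]) + t·E₃(p[u ↦ 1]) ≤ E₃(p[u ↦ t])`, i.e. `t ↦ E₃` lies above its chords (it is concave: the slack is
  `(1 − t)·t·(2 − t)·Q³` in the all-equal shape and `(1 − q_C)·(1 − t)·t·Q²` in the two-equal shape, zero otherwise).
  Consequence (memo §28d, not formalised here): once the environment of the root is revealed, revealing further ROOT pairs can only lower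
  the conditional Sahi cubic on average; in particular the root-pair chord inequality — false in general (ttrl, bypass family) — holds
  whenever `G − s` is deterministic, and the dual-revelation slack `D′` is the minimum of the whole revelation family above the environment.
  For NON-laminar triples the coordinate chords fail (e.g. `A = {0,1}, B = {0}, C = {0,1}`, `p = (99/100, 2/3)`, `u = 1`: slack `−2.2·10⁻⁵`).
-/

noncomputable section

namespace Summit.CriticalPhenomena.PercolationContinuityZ3.Theorems

namespace SahiHitting

open Finset Literature.Probability.Percolation Literature.Probability.Percolation.DecisionTree

variable {ι : Type*} [DecidableEq ι]

/-! ### Avoidance products -/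

omit [DecidableEq ι] in
/-- The avoidance product is multiplicative over disjoint unions: `q(X ∪ Y) = q(X)·q(Y)` when `X ∩ Y = ∅`. [folklore] -/
theorem prod_avoid_union [DecidableEq ι] (D : Finset ι) (p : ι → ℝ) {X Y : Finset ι} (h : Disjoint X Y) :
    ∏ i ∈ D, (if i ∈ X ∪ Y then 1 - p i else (1 : ℝ)) =
      (∏ i ∈ D, (if i ∈ X then 1 - p i else (1 : ℝ))) * ∏ i ∈ D, (if i ∈ Y then 1 - p i else (1 : ℝ)) := by
  rw [← Finset.prod_mul_distrib]
  refine Finset.prod_congr rfl fun i _ => ?_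
  by_cases hX : i ∈ X
  · have hY : i ∉ Y := Finset.disjoint_left.1 h hX
    simp [hX, hY]
  · by_cases hY : i ∈ Y
    · simp [hX, hY]
    · simp [hX, hY]

/-- Along one coordinate `u ∈ D` the avoidance product of `X` at `p[u ↦ t]` is `(1 − t)` or `1` (according as `u ∈ X` or not) times the
`t`-free product over `D ∖ {u}`. [folklore] -/
theorem prod_avoid_update (D : Finset ι) (p : ι → ℝ) (X : Finset ι) {u : ι} (hu : u ∈ D) (t : ℝ) :
    ∏ i ∈ D, (if i ∈ X then 1 - Function.update p u t i else (1 : ℝ)) =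
      (if u ∈ X then 1 - t else (1 : ℝ)) * ∏ i ∈ D.erase u, (if i ∈ X then 1 - p i else (1 : ℝ)) := by
  rw [← Finset.mul_prod_erase D (fun i => if i ∈ X then 1 - Function.update p u t i else (1 : ℝ)) hu]
  congr 1
  · simp only [Function.update_self]
  · refine Finset.prod_congr rfl fun i hi => ?_
    have hiu : i ≠ u := Finset.ne_of_mem_erase hi
    rw [Function.update_of_ne hiu]

omit [DecidableEq ι] in
/-- An avoidance product is nonnegative (`p ≤ 1`). [folklore] -/
theorem prod_avoid_nonneg [DecidableEq ι] (D : Finset ι) {p : ι → ℝ} (hp1 : ∀ i, p i ≤ 1) (X : Finset ι) :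
    0 ≤ ∏ i ∈ D, (if i ∈ X then 1 - p i else (1 : ℝ)) :=
  Finset.prod_nonneg fun i _ => by split_ifs <;> [exact sub_nonneg.2 (hp1 i); exact zero_le_one]

omit [DecidableEq ι] in
/-- An avoidance product is at most one (`0 ≤ p ≤ 1`). [folklore] -/
theorem prod_avoid_le_one [DecidableEq ι] (D : Finset ι) {p : ι → ℝ} (hp0 : ∀ i, 0 ≤ p i) (hp1 : ∀ i, p i ≤ 1) (X : Finset ι) :
    ∏ i ∈ D, (if i ∈ X then 1 - p i else (1 : ℝ)) ≤ 1 :=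
  Finset.prod_le_one (fun i _ => by split_ifs <;> [exact sub_nonneg.2 (hp1 i); exact zero_le_one])
    fun i _ => by split_ifs <;> [linarith [hp0 i]; exact le_rfl]

/-! ### Moments of hitting indicators -/

/-- One hitting indicator: `E u_X = 1 − q(X)`. [folklore] -/
theorem ED_hit_one (D : Finset ι) (p : ι → ℝ) (X : Finset ι) :
    ED D p (fun S => if Disjoint S X then (0 : ℝ) else 1) = 1 - ∏ i ∈ D, (if i ∈ X then 1 - p i else (1 : ℝ)) := by
  have h : (fun S : Finset ι => if Disjoint S X then (0 : ℝ) else 1) =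
      fun S => (1 : ℝ) - (if Disjoint S X then (1 : ℝ) else 0) := by
    funext S; split_ifs <;> norm_num
  rw [h, ED_sub', ED_one, ED_avoid]

/-- Two hitting indicators: `E[u_X u_Y] = 1 − q(X) − q(Y) + q(X ∪ Y)` (inclusion–exclusion). [folklore] -/
theorem ED_hit_two (D : Finset ι) (p : ι → ℝ) (X Y : Finset ι) :
    ED D p (fun S => (if Disjoint S X then (0 : ℝ) else 1) * (if Disjoint S Y then (0 : ℝ) else 1)) =
      1 - (∏ i ∈ D, (if i ∈ X then 1 - p i else (1 : ℝ))) - (∏ i ∈ D, (if i ∈ Y then 1 - p i else (1 : ℝ)))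
        + ∏ i ∈ D, (if i ∈ X ∪ Y then 1 - p i else (1 : ℝ)) := by
  have h : (fun S : Finset ι => (if Disjoint S X then (0 : ℝ) else 1) * (if Disjoint S Y then (0 : ℝ) else 1)) =
      fun S => (((1 : ℝ) - (if Disjoint S X then (1 : ℝ) else 0)) - (if Disjoint S Y then (1 : ℝ) else 0))
        + (if Disjoint S (X ∪ Y) then (1 : ℝ) else 0) := by
    funext S
    by_cases h1 : Disjoint S X <;> by_cases h2 : Disjoint S Y <;> simp [h1, h2, Finset.disjoint_union_right]
  rw [h, ED_add, ED_sub', ED_sub', ED_one, ED_avoid, ED_avoid, ED_avoid]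

/-- Three hitting indicators (inclusion–exclusion over the three avoidance events). [folklore] -/
theorem ED_hit_three (D : Finset ι) (p : ι → ℝ) (X Y W : Finset ι) :
    ED D p (fun S => (if Disjoint S X then (0 : ℝ) else 1) * (if Disjoint S Y then (0 : ℝ) else 1)
        * (if Disjoint S W then (0 : ℝ) else 1)) =
      1 - (∏ i ∈ D, (if i ∈ X then 1 - p i else (1 : ℝ))) - (∏ i ∈ D, (if i ∈ Y then 1 - p i else (1 : ℝ)))
        - (∏ i ∈ D, (if i ∈ W then 1 - p i else (1 : ℝ)))
        + (∏ i ∈ D, (if i ∈ X ∪ Y then 1 - p i else (1 : ℝ))) + (∏ i ∈ D, (if i ∈ X ∪ W then 1 - p i else (1 : ℝ)))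
        + (∏ i ∈ D, (if i ∈ Y ∪ W then 1 - p i else (1 : ℝ)))
        - ∏ i ∈ D, (if i ∈ X ∪ Y ∪ W then 1 - p i else (1 : ℝ)) := by
  have h : (fun S : Finset ι => (if Disjoint S X then (0 : ℝ) else 1) * (if Disjoint S Y then (0 : ℝ) else 1)
        * (if Disjoint S W then (0 : ℝ) else 1)) =
      fun S => (((((((1 : ℝ) - (if Disjoint S X then (1 : ℝ) else 0)) - (if Disjoint S Y then (1 : ℝ) else 0))
        - (if Disjoint S W then (1 : ℝ) else 0))
        + (if Disjoint S (X ∪ Y) then (1 : ℝ) else 0)) + (if Disjoint S (X ∪ W) then (1 : ℝ) else 0))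
        + (if Disjoint S (Y ∪ W) then (1 : ℝ) else 0))
        - (if Disjoint S (X ∪ Y ∪ W) then (1 : ℝ) else 0) := by
    funext S
    by_cases h1 : Disjoint S X <;> by_cases h2 : Disjoint S Y <;> by_cases h3 : Disjoint S W <;>
      simp [h1, h2, h3, Finset.disjoint_union_right]
  rw [h, ED_sub', ED_add, ED_add, ED_add, ED_sub', ED_sub', ED_sub', ED_one,
    ED_avoid, ED_avoid, ED_avoid, ED_avoid, ED_avoid, ED_avoid, ED_avoid]

/-- **Sahi's cubic of three hitting indicators through the seven avoidance products** (no assumption on `A, B, C`). [this work] -/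
theorem sahiE3_hitting_expand (D : Finset ι) (p : ι → ℝ) (A B C : Finset ι) :
    let u : Finset ι → Finset ι → ℝ := fun X S => if Disjoint S X then 0 else 1
    let q : Finset ι → ℝ := fun X => ∏ i ∈ D, (if i ∈ X then 1 - p i else (1 : ℝ))
    2 * ED D p (fun S => u A S * u B S * u C S) + ED D p (u A) * ED D p (u B) * ED D p (u C)
        - ED D p (u A) * ED D p (fun S => u B S * u C S) - ED D p (u B) * ED D p (fun S => u A S * u C S)
        - ED D p (u C) * ED D p (fun S => u A S * u B S)
      = 2 * (1 - q A - q B - q C + q (A ∪ B) + q (A ∪ C) + q (B ∪ C) - q (A ∪ B ∪ C))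
        + (1 - q A) * (1 - q B) * (1 - q C)
        - (1 - q A) * (1 - q B - q C + q (B ∪ C)) - (1 - q B) * (1 - q A - q C + q (A ∪ C))
        - (1 - q C) * (1 - q A - q B + q (A ∪ B)) := by
  intro u q
  simp only [u, q]
  rw [ED_hit_three, ED_hit_two, ED_hit_two, ED_hit_two, ED_hit_one, ED_hit_one, ED_hit_one]

/-! ### Closed forms in the laminar shapes -/

/-- **All three sets equal**: `E₃(u_A,u_A,u_A) = (1 − q_A)·q_A·(1 + q_A)`. [this work] -/
theorem sahiE3_hitting_eq_of_eq_eq (D : Finset ι) (p : ι → ℝ) (A : Finset ι) :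
    let u : Finset ι → Finset ι → ℝ := fun X S => if Disjoint S X then 0 else 1
    let q : Finset ι → ℝ := fun X => ∏ i ∈ D, (if i ∈ X then 1 - p i else (1 : ℝ))
    2 * ED D p (fun S => u A S * u A S * u A S) + ED D p (u A) * ED D p (u A) * ED D p (u A)
        - ED D p (u A) * ED D p (fun S => u A S * u A S) - ED D p (u A) * ED D p (fun S => u A S * u A S)
        - ED D p (u A) * ED D p (fun S => u A S * u A S)
      = (1 - q A) * q A * (1 + q A) := by
  intro u q
  have h := sahiE3_hitting_expand D p A A A
  simp only [] at h
  simp only [u, q]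
  rw [h]
  simp only [Finset.union_self]
  ring

/-- **Two equal, the third disjoint** (repeated set in the first two slots): `E₃(u_A,u_A,u_C) = (1 − q_C)·(1 − q_A)·q_A`. [this work] -/
theorem sahiE3_hitting_eq_of_eq_disjoint (D : Finset ι) (p : ι → ℝ) {A C : Finset ι} (hAC : Disjoint A C) :
    let u : Finset ι → Finset ι → ℝ := fun X S => if Disjoint S X then 0 else 1
    let q : Finset ι → ℝ := fun X => ∏ i ∈ D, (if i ∈ X then 1 - p i else (1 : ℝ))
    2 * ED D p (fun S => u A S * u A S * u C S) + ED D p (u A) * ED D p (u A) * ED D p (u C)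
        - ED D p (u A) * ED D p (fun S => u A S * u C S) - ED D p (u A) * ED D p (fun S => u A S * u C S)
        - ED D p (u C) * ED D p (fun S => u A S * u A S)
      = (1 - q C) * (1 - q A) * q A := by
  intro u q
  have h := sahiE3_hitting_expand D p A A C
  simp only [] at h
  simp only [u, q]
  rw [h]
  simp only [Finset.union_self]
  rw [prod_avoid_union D p hAC]
  ring

/-- Two equal, the third disjoint — repeated set in the LAST two slots: `E₃(u_C,u_A,u_A) = (1 − q_C)·(1 − q_A)·q_A`. [this work] -/
theorem sahiE3_hitting_eq_of_disjoint_eq (D : Finset ι) (p : ι → ℝ) {A C : Finset ι} (hAC : Disjoint A C) :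
    let u : Finset ι → Finset ι → ℝ := fun X S => if Disjoint S X then 0 else 1
    let q : Finset ι → ℝ := fun X => ∏ i ∈ D, (if i ∈ X then 1 - p i else (1 : ℝ))
    2 * ED D p (fun S => u C S * u A S * u A S) + ED D p (u C) * ED D p (u A) * ED D p (u A)
        - ED D p (u C) * ED D p (fun S => u A S * u A S) - ED D p (u A) * ED D p (fun S => u C S * u A S)
        - ED D p (u A) * ED D p (fun S => u C S * u A S)
      = (1 - q C) * (1 - q A) * q A := by
  intro u q
  have h := sahiE3_hitting_expand D p C A A
  simp only [] at h
  simp only [u, q]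
  rw [h]
  simp only [Finset.union_self]
  have hCA : Disjoint C A := hAC.symm
  rw [Finset.union_assoc, Finset.union_self, prod_avoid_union D p hCA]
  ring

/-- Two equal, the third disjoint — repeated set in the OUTER slots: `E₃(u_A,u_C,u_A) = (1 − q_C)·(1 − q_A)·q_A`. [this work] -/
theorem sahiE3_hitting_eq_of_eq_mid_disjoint (D : Finset ι) (p : ι → ℝ) {A C : Finset ι} (hAC : Disjoint A C) :
    let u : Finset ι → Finset ι → ℝ := fun X S => if Disjoint S X then 0 else 1
    let q : Finset ι → ℝ := fun X => ∏ i ∈ D, (if i ∈ X then 1 - p i else (1 : ℝ))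
    2 * ED D p (fun S => u A S * u C S * u A S) + ED D p (u A) * ED D p (u C) * ED D p (u A)
        - ED D p (u A) * ED D p (fun S => u C S * u A S) - ED D p (u C) * ED D p (fun S => u A S * u A S)
        - ED D p (u A) * ED D p (fun S => u A S * u C S)
      = (1 - q C) * (1 - q A) * q A := by
  intro u q
  have h := sahiE3_hitting_expand D p A C A
  simp only [] at h
  simp only [u, q]
  rw [h]
  simp only [Finset.union_self]
  have hCA : Disjoint C A := hAC.symm
  rw [Finset.union_right_comm, Finset.union_self, prod_avoid_union D p hAC, prod_avoid_union D p hCA]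
  ring

/-- **Pairwise disjoint sets**: the three hitting events are independent and `E₃ = 0`. [this work] -/
theorem sahiE3_hitting_eq_zero_of_pairwise_disjoint (D : Finset ι) (p : ι → ℝ) {A B C : Finset ι}
    (hAB : Disjoint A B) (hAC : Disjoint A C) (hBC : Disjoint B C) :
    let u : Finset ι → Finset ι → ℝ := fun X S => if Disjoint S X then 0 else 1
    2 * ED D p (fun S => u A S * u B S * u C S) + ED D p (u A) * ED D p (u B) * ED D p (u C)
        - ED D p (u A) * ED D p (fun S => u B S * u C S) - ED D p (u B) * ED D p (fun S => u A S * u C S)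
        - ED D p (u C) * ED D p (fun S => u A S * u B S) = 0 := by
  intro u
  have h := sahiE3_hitting_expand D p A B C
  simp only [] at h
  simp only [u]
  rw [h]
  have hABC : Disjoint (A ∪ B) C := Finset.disjoint_union_left.2 ⟨hAC, hBC⟩
  rw [prod_avoid_union D p hABC, prod_avoid_union D p hAB, prod_avoid_union D p hAC, prod_avoid_union D p hBC]
  ring

/-! ### The chord inequality along one coordinate -/

/-- **Laminar hitting triples lie above their chords along every coordinate.**  For `A, B, C` pairwise equal or disjoint,
`u ∈ D` and `t ∈ [0,1]` (other coordinate probabilities in `[0,1]`), with `E₃(r)` Sahi's cubic of `u_A, u_B, u_C` under the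
coordinate probabilities `r`: `(1 − t)·E₃(p[u ↦ 0]) + t·E₃(p[u ↦ 1]) ≤ E₃(p[u ↦ t])`. [this work] -/
theorem sahiE3_hitting_laminar_chord (D : Finset ι) {p : ι → ℝ} (hp0 : ∀ i, 0 ≤ p i) (hp1 : ∀ i, p i ≤ 1)
    {A B C : Finset ι} (hAB : A = B ∨ Disjoint A B) (hAC : A = C ∨ Disjoint A C) (hBC : B = C ∨ Disjoint B C)
    {u₀ : ι} (hu₀ : u₀ ∈ D) {t : ℝ} (ht0 : 0 ≤ t) (ht1 : t ≤ 1) :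
    let u : Finset ι → Finset ι → ℝ := fun X S => if Disjoint S X then 0 else 1
    let E : (ι → ℝ) → ℝ := fun r =>
      2 * ED D r (fun S => u A S * u B S * u C S) + ED D r (u A) * ED D r (u B) * ED D r (u C)
        - ED D r (u A) * ED D r (fun S => u B S * u C S) - ED D r (u B) * ED D r (fun S => u A S * u C S)
        - ED D r (u C) * ED D r (fun S => u A S * u B S)
    (1 - t) * E (Function.update p u₀ 0) + t * E (Function.update p u₀ 1) ≤ E (Function.update p u₀ t) := by
  intro u E
  -- the `t`-free avoidance products over `D ∖ {u₀}`
  set QA : ℝ := ∏ i ∈ D.erase u₀, (if i ∈ A then 1 - p i else (1 : ℝ)) with hQA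
  set QC : ℝ := ∏ i ∈ D.erase u₀, (if i ∈ C then 1 - p i else (1 : ℝ)) with hQC
  set QB : ℝ := ∏ i ∈ D.erase u₀, (if i ∈ B then 1 - p i else (1 : ℝ)) with hQB
  have hQA0 : 0 ≤ QA := prod_avoid_nonneg (D.erase u₀) hp1 A
  have hQB0 : 0 ≤ QB := prod_avoid_nonneg (D.erase u₀) hp1 B
  have hQC0 : 0 ≤ QC := prod_avoid_nonneg (D.erase u₀) hp1 C
  have hQA1 : QA ≤ 1 := prod_avoid_le_one (D.erase u₀) hp0 hp1 A
  have hQB1 : QB ≤ 1 := prod_avoid_le_one (D.erase u₀) hp0 hp1 B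
  have hQC1 : QC ≤ 1 := prod_avoid_le_one (D.erase u₀) hp0 hp1 C
  have h1t : 0 ≤ 1 - t := sub_nonneg.2 ht1
  -- avoidance products at the three updated weights
  have qA : ∀ s : ℝ, ∏ i ∈ D, (if i ∈ A then 1 - Function.update p u₀ s i else (1 : ℝ)) =
      (if u₀ ∈ A then 1 - s else (1 : ℝ)) * QA := fun s => prod_avoid_update D p A hu₀ s
  have qB : ∀ s : ℝ, ∏ i ∈ D, (if i ∈ B then 1 - Function.update p u₀ s i else (1 : ℝ)) =
      (if u₀ ∈ B then 1 - s else (1 : ℝ)) * QB := fun s => prod_avoid_update D p B hu₀ s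
  have qC : ∀ s : ℝ, ∏ i ∈ D, (if i ∈ C then 1 - Function.update p u₀ s i else (1 : ℝ)) =
      (if u₀ ∈ C then 1 - s else (1 : ℝ)) * QC := fun s => prod_avoid_update D p C hu₀ s
  rcases hAB with hAB | hAB
  · subst hAB
    rcases hAC with hAC | hAC
    · -- shape A = A = A
      subst hAC
      have hE : ∀ s : ℝ, E (Function.update p u₀ s) =
          (1 - (if u₀ ∈ A then 1 - s else (1 : ℝ)) * QA) * ((if u₀ ∈ A then 1 - s else (1 : ℝ)) * QA)
            * (1 + (if u₀ ∈ A then 1 - s else (1 : ℝ)) * QA) := by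
        intro s
        have h := sahiE3_hitting_eq_of_eq_eq D (Function.update p u₀ s) A
        simp only [] at h
        simp only [E, u]
        rw [h, qA s]
      rw [hE 0, hE 1, hE t]
      by_cases hA : u₀ ∈ A
      · simp only [hA, if_true]
        have key : (1 - (1 - t) * QA) * ((1 - t) * QA) * (1 + (1 - t) * QA)
            - ((1 - t) * ((1 - (1 - 0) * QA) * ((1 - 0) * QA) * (1 + (1 - 0) * QA))
              + t * ((1 - (1 - 1) * QA) * ((1 - 1) * QA) * (1 + (1 - 1) * QA)))
            = (1 - t) * t * (2 - t) * QA ^ 3 := by ring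
        have hnn : 0 ≤ (1 - t) * t * (2 - t) * QA ^ 3 :=
          mul_nonneg (mul_nonneg (mul_nonneg h1t ht0) (by linarith)) (pow_nonneg hQA0 3)
        linarith [key, hnn]
      · simp only [hA, if_false]
        ring_nf
        exact le_rfl
    · -- shape A = A, C disjoint (then `hBC` is `A = C ∨ Disjoint A C`; both fine)
      have hE : ∀ s : ℝ, E (Function.update p u₀ s) =
          (1 - (if u₀ ∈ C then 1 - s else (1 : ℝ)) * QC) * (1 - (if u₀ ∈ A then 1 - s else (1 : ℝ)) * QA)
            * ((if u₀ ∈ A then 1 - s else (1 : ℝ)) * QA) := by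
        intro s
        have h := sahiE3_hitting_eq_of_eq_disjoint D (Function.update p u₀ s) hAC
        simp only [] at h
        simp only [E, u]
        rw [h, qA s, qC s]
      rw [hE 0, hE 1, hE t]
      by_cases hA : u₀ ∈ A
      · have hC : u₀ ∉ C := Finset.disjoint_left.1 hAC hA
        simp only [hA, hC, if_true, if_false]
        have key : (1 - 1 * QC) * (1 - (1 - t) * QA) * ((1 - t) * QA)
            - ((1 - t) * ((1 - 1 * QC) * (1 - (1 - 0) * QA) * ((1 - 0) * QA))
              + t * ((1 - 1 * QC) * (1 - (1 - 1) * QA) * ((1 - 1) * QA)))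
            = (1 - QC) * ((1 - t) * t) * QA ^ 2 := by ring
        have hnn : 0 ≤ (1 - QC) * ((1 - t) * t) * QA ^ 2 :=
          mul_nonneg (mul_nonneg (sub_nonneg.2 hQC1) (mul_nonneg h1t ht0)) (pow_nonneg hQA0 2)
        linarith [key, hnn]
      · by_cases hC : u₀ ∈ C
        · simp only [hA, hC, if_true, if_false]
          ring_nf
          exact le_rfl
        · simp only [hA, hC, if_false]
          ring_nf
          exact le_rfl
  · rcases hAC with hAC | hAC
    · -- shape A = C, B disjoint: repeated set in the outer slots
      subst hAC
      have hE : ∀ s : ℝ, E (Function.update p u₀ s) =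
          (1 - (if u₀ ∈ B then 1 - s else (1 : ℝ)) * QB) * (1 - (if u₀ ∈ A then 1 - s else (1 : ℝ)) * QA)
            * ((if u₀ ∈ A then 1 - s else (1 : ℝ)) * QA) := by
        intro s
        have h := sahiE3_hitting_eq_of_eq_mid_disjoint D (Function.update p u₀ s) hAB
        simp only [] at h
        simp only [E, u]
        rw [h, qA s, qB s]
      rw [hE 0, hE 1, hE t]
      by_cases hA : u₀ ∈ A
      · have hB : u₀ ∉ B := Finset.disjoint_left.1 hAB hA
        simp only [hA, hB, if_true, if_false]
        have key : (1 - 1 * QB) * (1 - (1 - t) * QA) * ((1 - t) * QA)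
            - ((1 - t) * ((1 - 1 * QB) * (1 - (1 - 0) * QA) * ((1 - 0) * QA))
              + t * ((1 - 1 * QB) * (1 - (1 - 1) * QA) * ((1 - 1) * QA)))
            = (1 - QB) * ((1 - t) * t) * QA ^ 2 := by ring
        have hnn : 0 ≤ (1 - QB) * ((1 - t) * t) * QA ^ 2 :=
          mul_nonneg (mul_nonneg (sub_nonneg.2 hQB1) (mul_nonneg h1t ht0)) (pow_nonneg hQA0 2)
        linarith [key, hnn]
      · by_cases hB : u₀ ∈ B
        · simp only [hA, hB, if_true, if_false]
          ring_nf
          exact le_rfl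
        · simp only [hA, hB, if_false]
          ring_nf
          exact le_rfl
    · rcases hBC with hBC | hBC
      · -- shape B = C, A disjoint: repeated set in the last two slots
        subst hBC
        have hE : ∀ s : ℝ, E (Function.update p u₀ s) =
            (1 - (if u₀ ∈ A then 1 - s else (1 : ℝ)) * QA) * (1 - (if u₀ ∈ B then 1 - s else (1 : ℝ)) * QB)
              * ((if u₀ ∈ B then 1 - s else (1 : ℝ)) * QB) := by
          intro s
          have h := sahiE3_hitting_eq_of_disjoint_eq D (Function.update p u₀ s) hAB.symm
          simp only [] at h
          simp only [E, u]
          rw [h, qA s, qB s]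
        rw [hE 0, hE 1, hE t]
        by_cases hB : u₀ ∈ B
        · have hA : u₀ ∉ A := fun hA => (Finset.disjoint_left.1 hAB hA) hB
          simp only [hA, hB, if_true, if_false]
          have key : (1 - 1 * QA) * (1 - (1 - t) * QB) * ((1 - t) * QB)
              - ((1 - t) * ((1 - 1 * QA) * (1 - (1 - 0) * QB) * ((1 - 0) * QB))
                + t * ((1 - 1 * QA) * (1 - (1 - 1) * QB) * ((1 - 1) * QB)))
              = (1 - QA) * ((1 - t) * t) * QB ^ 2 := by ring
          have hnn : 0 ≤ (1 - QA) * ((1 - t) * t) * QB ^ 2 :=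
            mul_nonneg (mul_nonneg (sub_nonneg.2 hQA1) (mul_nonneg h1t ht0)) (pow_nonneg hQB0 2)
          linarith [key, hnn]
        · by_cases hA : u₀ ∈ A
          · simp only [hA, hB, if_true, if_false]
            ring_nf
            exact le_rfl
          · simp only [hA, hB, if_false]
            ring_nf
            exact le_rfl
      · -- pairwise disjoint: `E ≡ 0`
        have hE : ∀ s : ℝ, E (Function.update p u₀ s) = 0 := by
          intro s
          have h := sahiE3_hitting_eq_zero_of_pairwise_disjoint D (Function.update p u₀ s) hAB hAC hBC
          simp only [] at h
          simp only [E, u]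
          rw [h]
        rw [hE 0, hE 1, hE t]
        ring_nf
        exact le_rfl

end SahiHitting

end Summit.CriticalPhenomena.PercolationContinuityZ3.Theorems
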